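import Literature.AlgebraicGeometry.Motives.HodgeStructureLefschetzGroupCenterPointsCount
import HarnessLib

/-!
# `S₀(A)(K) ≅ {IDEMPOTENTS OF C₀ ⊗ K}` FOR `†` OF THE FIRST KIND: A CENTRAL `γ ∈ S(A)(K)` IS `γ = 1 − 2e` FOR A UNIQUE IDEMPOTENT
# `e` OF `Z(C(H)(K)) = C₀ ⊗ K`, WITH `V₋(γ) = e(V ⊗ K)`, `V₊(γ) = ker e` — the blocks of `V ⊗ K` cut out by the idempotents of
# the centre (Milne 1999 §1 p. 645 «`C₀(A)` is a product of fields», `S₀(A)(R)`, Prop. 1.7, Remark 1.6; Moonen–Zarhin 1998 §1 Lemma (1))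

[topic AlgebraicGeometry/Motives]

Layer `Literature/AlgebraicGeometry/Motives`, lane `lit-hodgefound` (Track 2 foundations library; prover seat
`lit-hodgefound-p02`, generation 55, self-proposed row g55-#13). THEOREMS ONLY: no definition, no named fact (net debt `0`),
no instance, no notation.  For `†` of the first kind `S₀(A)(K) = {γ ∈ C₀ ⊗ K | γ² = 1} = μ₂(C₀ ⊗ K)` (Milne p. 645; on `K`-points
g55-#8 `Polarization.natCard_center_lefschetzGroupBaseChange_eq_natCard_mul_self_eq_one`), and in a commutative ring in which `2`
is a unit the involutions `z` (`z² = 1`) correspond bijectively to the idempotents `e` under `z = 1 − 2e`, `e = ½(1 − z)`; the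
`2^{t_K}` idempotents of `C₀ ⊗ K ≅ L₁ × ⋯ × L_{t_K}` are the sums of the primitive ones.  Hence:
(i) `#Z(S(H)(K)) = #{idempotents of Z(C(H)(K))}`;
(ii) every central `γ ∈ S(H)(K)` is `1 − 2e` on `K ⊗ V` for an idempotent `e ∈ Z(C(H)(K))`, unique, and then
`V₋(γ) = ker(γ + 1) = e(K ⊗ V)`, `V₊(γ) = ker(γ − 1) = ker e` — the action of `S₀` on `V ⊗ K` is by signs on the blocks
`e(K ⊗ V)` of the central idempotents («together with their actions on `V(A)`», §2).

## The sources, verbatim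

* J. S. Milne, *Lefschetz classes on abelian varieties*, Duke Math. J. 96 (1999) 639–675 [Milne1999LefschetzClasses] (held
  `paper:doi-10-1215-s0012-7094-99-09620-5`): folio 7 = p. 645 L1–L14 «let `C₀(A)` be the centre of the `ℚ`-algebra `End⁰(A)` —
  it is a product of fields … `S₀(A)(R) = {γ ∈ C₀(A) ⊗_ℚ R | γ†γ = 1}` … Proposition 1.7 … an isomorphism of algebraic groups
  `S₀(A)_{/ℚ_ℓ} → S_ℓ(A)`», §2 L1–L3 «We wish to calculate `C(A)` and `S(A)`, together with their actions on `V(A)`»; folio 6 =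
  p. 644 Remark 1.6 «`C'(A) ≅ C(A) ⊗_k k'`, `S'(A) ≅ S(A)_{/k'}`».
* B. J. J. Moonen, Yu. G. Zarhin, *Weil classes on abelian varieties*, J. reine angew. Math. 496 (1998) 83–92
  [MoonenZarhin1998WeilClasses] (held `paper:arxiv-alg-geom_9612017`, chunk p0002 L121–L127): «Lemma. (1) The center of
  `G_div(X)` is the group `U_{K_B}` given by `U_{K_B}(R) = {a ∈ (K_B ⊗_ℚ R)^* ∣ a a† = 1}` …»
* H. Lange, *Abelian Varieties over the Complex Numbers* (2023) [Lange2023AbelianVarietiesComplex], §2.6.2 Lemma 2.6.4.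

Nearest tree results, BY NAME: g55-#8 `Polarization.natCard_center_lefschetzGroupBaseChange_eq_natCard_mul_self_eq_one`,
`Polarization.exists_mem_center_lefschetzGroupBaseChange_coe_eq_of_mul_self_eq_one`; g54-#4
`Polarization.mem_center_lefschetzGroupBaseChange_iff_mem_center_centralizer`; g54-#6
`Polarization.coe_mul_coe_eq_one_of_mem_center_lefschetzGroupBaseChange`.

## Dictionary and what is proved (namespace `Literature.AlgebraicGeometry.Motives.HodgeStructure`)

`S(H)(K) = ψ.lefschetzGroupBaseChange K`, `C(H)(K)` = `Subalgebra.centralizer K {a_K}`, `Z_K = Subalgebra.center K C(H)(K)`,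
`V_ε(γ) = Module.End.eigenspace ↑γ ε` on `K ⊗ V`; "first kind" = `∀ z ∈ Z(E_φ), z† = z`.

* §1 **`Polarization.natCard_center_lefschetzGroupBaseChange_eq_natCard_isIdempotentElem`** (`#Z(S(H)(K)) = #{e ∈ Z_K | e² = e}`).
* §2 **`Polarization.exists_isIdempotentElem_coe_eq_one_sub_of_mem_center_lefschetzGroupBaseChange`** (`γ = 1 − 2e`, `e ∈ Z_K`
  idempotent), **`Polarization.exists_mem_center_lefschetzGroupBaseChange_coe_eq_one_sub_of_isIdempotentElem`** (conversely),
  **`Polarization.eigenspace_neg_one_eq_range_of_coe_eq_one_sub`** (`V₋(γ) = e(K ⊗ V)`),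
  **`Polarization.eigenspace_one_eq_ker_of_coe_eq_one_sub`** (`V₊(γ) = ker e`),
  **`Polarization.isIdempotentElem_unique_of_coe_eq_one_sub`** (`e` is unique).
-/

noncomputable section

open scoped TensorProduct

namespace Literature.AlgebraicGeometry.Motives

namespace HodgeStructure

universe u uK

variable (K : Type uK) [Field K] [Algebra ℚ K] {V : Type u} [AddCommGroup V] [Module ℚ V] [Module.Finite ℚ V] {n : ℤ}
  {H : HodgeStructure V n}

/-! ## §0 Algebra: involutions `↔` idempotents when `2` is a unit -/

omit [Algebra ℚ K] [Module.Finite ℚ V] in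
/-- **`z ↦ ½(1 − z)` IS A BIJECTION `{z | z² = 1} ≅ {e | e² = e}` WITH INVERSE `e ↦ 1 − 2e`**, in a commutative ring in which `2` is
a unit. [folklore] -/
private theorem exists_equiv_mul_self_eq_one_isIdempotentElem₅₅₁₃ {Z : Type*} [CommRing Z] (h2 : IsUnit (2 : Z)) :
    ∃ φ : {z : Z // z * z = 1} ≃ {e : Z // IsIdempotentElem e},
      ∀ z : {z : Z // z * z = 1}, (z : Z) = 1 - ((φ z : Z) + (φ z : Z)) := by
  obtain ⟨w, hw⟩ := h2.exists_left_inv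
  refine ⟨{ toFun := fun z => ⟨w * (1 - z), ?_⟩,
            invFun := fun e => ⟨1 - ((e : Z) + e), ?_⟩,
            left_inv := fun z => Subtype.ext ?_,
            right_inv := fun e => Subtype.ext ?_ }, fun z => ?_⟩
  · change w * (1 - (z : Z)) * (w * (1 - z)) = w * (1 - z)
    linear_combination (w * (1 - (z : Z))) * hw + w * w * z.2
  · linear_combination (4 : Z) * e.2.eq
  · change 1 - (w * (1 - (z : Z)) + w * (1 - z)) = z
    linear_combination ((z : Z) - 1) * hw
  · change w * (1 - (1 - ((e : Z) + e))) = e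
    linear_combination (e : Z) * hw
  · change (z : Z) = 1 - (w * (1 - z) + w * (1 - z))
    linear_combination (1 - (z : Z)) * hw

omit [Algebra ℚ K] [Module.Finite ℚ V] in
/-- `(1 − 2e)² = 1` for an idempotent `e` of a commutative ring. [folklore] -/
private theorem one_sub_mul_self_eq_one_of_isIdempotentElem₅₅₁₃ {Z : Type*} [CommRing Z] {e : Z} (he : IsIdempotentElem e) :
    (1 - (e + e)) * (1 - (e + e)) = 1 := by
  linear_combination (4 : Z) * he.eq

set_option maxSynthPendingDepth 4 in
omit [Module.Finite ℚ V] in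
/-- `2` is a unit of the `K`-algebra `Z_K` (`K ⊇ ℚ`). [folklore] -/
private theorem isUnit_two_center_centralizer₅₅₁₃ :
    IsUnit (2 : Subalgebra.center K (Subalgebra.centralizer K
      ((fun a : Module.End ℚ V => a.baseChange K) '' (H.endAlg : Set (Module.End ℚ V))))) := by
  have h2K : (2 : K) ≠ 0 := by
    rw [← map_ofNat (algebraMap ℚ K) 2]
    exact (map_ne_zero _).2 two_ne_zero
  rw [← map_ofNat (algebraMap K (Subalgebra.center K (Subalgebra.centralizer K
      ((fun a : Module.End ℚ V => a.baseChange K) '' (H.endAlg : Set (Module.End ℚ V)))))) 2]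
  exact (isUnit_iff_ne_zero.2 h2K).map _

omit [Algebra ℚ K] [Module.Finite ℚ V] in
/-- In a `K`-space with `2 ≠ 0`: `x + x = y + y ⟹ x = y`. [folklore] -/
private theorem eq_of_add_self_eq₅₅₁₃ (h2 : (2 : K) ≠ 0) {M : Type*} [AddCommGroup M] [Module K M] {x y : M}
    (h : x + x = y + y) : x = y := by
  rw [← two_smul K x, ← two_smul K y] at h
  exact smul_right_injective M h2 h

/-! ## §1 `#Z(S(H)(K)) = #{idempotents of C₀ ⊗ K}` -/

set_option maxSynthPendingDepth 4 in
/-- **FIRST KIND: `#Z(S(A)(K))` IS THE NUMBER OF IDEMPOTENTS OF `Z(C(H)(K)) = C₀ ⊗ K`** — `Z(S(H)(K)) ≅ μ₂(C₀ ⊗ K)` (g55-#8) and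
`z ↦ ½(1 − z)` matches involutions with idempotents (`2` is a unit). [cite: Milne1999LefschetzClasses, §1 p. 645 L1–L14 (S₀, Prop. 1.7) and Remark 1.6 (p. 644)]
[cite: MoonenZarhin1998WeilClasses, §1 Lemma (1)] -/
theorem Polarization.natCard_center_lefschetzGroupBaseChange_eq_natCard_isIdempotentElem (ψ : Polarization H)
    (hfix : ∀ z : H.endAlg, z ∈ Subalgebra.center ℚ H.endAlg → ψ.adjoint (z : Module.End ℚ V) = z) :
    Nat.card (Subgroup.center (ψ.lefschetzGroupBaseChange K)) =
      Nat.card {e : Subalgebra.center K (Subalgebra.centralizer K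
        ((fun a : Module.End ℚ V => a.baseChange K) '' (H.endAlg : Set (Module.End ℚ V)))) // IsIdempotentElem e} := by
  obtain ⟨φ, -⟩ := exists_equiv_mul_self_eq_one_isIdempotentElem₅₅₁₃ (isUnit_two_center_centralizer₅₅₁₃ K (H := H))
  rw [ψ.natCard_center_lefschetzGroupBaseChange_eq_natCard_mul_self_eq_one K hfix, Nat.card_congr φ]

/-! ## §2 `γ = 1 − 2e`: the eigenblocks of a central `γ` are the blocks of an idempotent of the centre -/

set_option maxSynthPendingDepth 4 in
/-- **FIRST KIND: A CENTRAL `γ ∈ S(A)(K)` IS `1 − 2e` ON `K ⊗ V` FOR AN IDEMPOTENT `e ∈ Z(C(H)(K)) = C₀ ⊗ K`** (`↑γ` lies in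
`Z(C(H)(K))`, g54-#4, with `γ² = 1`, g54-#6; `e = ½(1 − γ)`). [cite: Milne1999LefschetzClasses, §1 p. 645 L1–L14 (S₀, Prop. 1.7), Remark 1.6 (p. 644) and §2 L1–L3]
[cite: MoonenZarhin1998WeilClasses, §1 Lemma (1)] -/
theorem Polarization.exists_isIdempotentElem_coe_eq_one_sub_of_mem_center_lefschetzGroupBaseChange (ψ : Polarization H)
    (hfix : ∀ z : H.endAlg, z ∈ Subalgebra.center ℚ H.endAlg → ψ.adjoint (z : Module.End ℚ V) = z)
    {γ : ψ.lefschetzGroupBaseChange K} (hγ : γ ∈ Subgroup.center (ψ.lefschetzGroupBaseChange K)) :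
    ∃ e : Subalgebra.center K (Subalgebra.centralizer K
        ((fun a : Module.End ℚ V => a.baseChange K) '' (H.endAlg : Set (Module.End ℚ V)))),
      IsIdempotentElem e ∧
        ((γ : (K ⊗[ℚ] V) ≃ₗ[K] (K ⊗[ℚ] V)) : Module.End K (K ⊗[ℚ] V)) =
          1 - ((((e : Subalgebra.centralizer K ((fun a : Module.End ℚ V => a.baseChange K) ''
            (H.endAlg : Set (Module.End ℚ V)))) : Module.End K (K ⊗[ℚ] V))) +
            ((e : Subalgebra.centralizer K ((fun a : Module.End ℚ V => a.baseChange K) ''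
              (H.endAlg : Set (Module.End ℚ V)))) : Module.End K (K ⊗[ℚ] V))) := by
  obtain ⟨φ, hφ⟩ := exists_equiv_mul_self_eq_one_isIdempotentElem₅₅₁₃ (isUnit_two_center_centralizer₅₅₁₃ K (H := H))
  have hz := (ψ.mem_center_lefschetzGroupBaseChange_iff_mem_center_centralizer K γ).1 hγ
  have hzz : (⟨_, hz⟩ : Subalgebra.center K (Subalgebra.centralizer K
      ((fun a : Module.End ℚ V => a.baseChange K) '' (H.endAlg : Set (Module.End ℚ V))))) * ⟨_, hz⟩ = 1 :=
    Subtype.ext (Subtype.ext (ψ.coe_mul_coe_eq_one_of_mem_center_lefschetzGroupBaseChange K hfix hγ))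
  refine ⟨φ ⟨⟨_, hz⟩, hzz⟩, (φ ⟨⟨_, hz⟩, hzz⟩).2, ?_⟩
  have h := congrArg (fun z : Subalgebra.center K (Subalgebra.centralizer K
      ((fun a : Module.End ℚ V => a.baseChange K) '' (H.endAlg : Set (Module.End ℚ V)))) =>
    ((z : Subalgebra.centralizer K ((fun a : Module.End ℚ V => a.baseChange K) ''
      (H.endAlg : Set (Module.End ℚ V)))) : Module.End K (K ⊗[ℚ] V))) (hφ ⟨⟨_, hz⟩, hzz⟩)
  exact h

set_option maxSynthPendingDepth 4 in
/-- **CONVERSELY, EVERY IDEMPOTENT `e ∈ Z(C(H)(K))` GIVES A CENTRAL `γ = 1 − 2e ∈ S(A)(K)`** (first kind; g55-#8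
`Polarization.exists_mem_center_lefschetzGroupBaseChange_coe_eq_of_mul_self_eq_one` applied to the involution `1 − 2e`).
[cite: Milne1999LefschetzClasses, §1 p. 645 L1–L14 (S₀, Prop. 1.7) and Remark 1.6 (p. 644)] [cite: MoonenZarhin1998WeilClasses, §1 Lemma (1)] -/
theorem Polarization.exists_mem_center_lefschetzGroupBaseChange_coe_eq_one_sub_of_isIdempotentElem (ψ : Polarization H)
    (hfix : ∀ z : H.endAlg, z ∈ Subalgebra.center ℚ H.endAlg → ψ.adjoint (z : Module.End ℚ V) = z)
    {e : Subalgebra.center K (Subalgebra.centralizer K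
      ((fun a : Module.End ℚ V => a.baseChange K) '' (H.endAlg : Set (Module.End ℚ V))))} (he : IsIdempotentElem e) :
    ∃ γ : ψ.lefschetzGroupBaseChange K, γ ∈ Subgroup.center (ψ.lefschetzGroupBaseChange K) ∧
      ((γ : (K ⊗[ℚ] V) ≃ₗ[K] (K ⊗[ℚ] V)) : Module.End K (K ⊗[ℚ] V)) =
        1 - ((((e : Subalgebra.centralizer K ((fun a : Module.End ℚ V => a.baseChange K) ''
          (H.endAlg : Set (Module.End ℚ V)))) : Module.End K (K ⊗[ℚ] V))) +
          ((e : Subalgebra.centralizer K ((fun a : Module.End ℚ V => a.baseChange K) ''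
            (H.endAlg : Set (Module.End ℚ V)))) : Module.End K (K ⊗[ℚ] V))) := by
  have hzz : (1 - (e + e)) * (1 - (e + e)) = 1 := one_sub_mul_self_eq_one_of_isIdempotentElem₅₅₁₃ he
  obtain ⟨γ, hγ, hγz⟩ := ψ.exists_mem_center_lefschetzGroupBaseChange_coe_eq_of_mul_self_eq_one K hfix (1 - (e + e)).2
    (congrArg Subtype.val hzz)
  exact ⟨γ, hγ, hγz⟩

omit [Module.Finite ℚ V] in
/-- **`V₋(γ) = e(K ⊗ V)` WHEN `γ = 1 − 2e` WITH `e` IDEMPOTENT** (`char K ≠ 2`): `γx = −x ⟺ x = ex`.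
[cite: Milne1999LefschetzClasses, §1 p. 645 L1–L14 and §2 L1–L3] -/
theorem Polarization.eigenspace_neg_one_eq_range_of_coe_eq_one_sub (ψ : Polarization H) {γ : ψ.lefschetzGroupBaseChange K}
    {e : Module.End K (K ⊗[ℚ] V)} (he : IsIdempotentElem e)
    (hγe : ((γ : (K ⊗[ℚ] V) ≃ₗ[K] (K ⊗[ℚ] V)) : Module.End K (K ⊗[ℚ] V)) = 1 - (e + e)) :
    Module.End.eigenspace (((γ : (K ⊗[ℚ] V) ≃ₗ[K] (K ⊗[ℚ] V)) : Module.End K (K ⊗[ℚ] V))) (-1) = LinearMap.range e := by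
  have h2K : (2 : K) ≠ 0 := by
    rw [← map_ofNat (algebraMap ℚ K) 2]
    exact (map_ne_zero _).2 two_ne_zero
  ext x
  rw [Module.End.mem_eigenspace_iff, hγe, LinearMap.sub_apply, Module.End.one_apply, LinearMap.add_apply, neg_one_smul,
    LinearMap.mem_range]
  constructor
  · intro h
    -- `x - (ex + ex) = -x` gives `x + x = ex + ex`, i.e. `x = ex`
    have h1 : x = -x + (e x + e x) := sub_eq_iff_eq_add.1 h
    have h' : x + x = e x + e x :=
      calc x + x = x + (-x + (e x + e x)) := by rw [← h1]
        _ = e x + e x := add_neg_cancel_left x _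
    exact ⟨x, (eq_of_add_self_eq₅₅₁₃ K h2K h').symm⟩
  · rintro ⟨y, rfl⟩
    rw [← Module.End.mul_apply, he.eq]
    abel

omit [Module.Finite ℚ V] in
/-- **`V₊(γ) = ker e` WHEN `γ = 1 − 2e`** (`char K ≠ 2`): `γx = x ⟺ ex = 0`. [cite: Milne1999LefschetzClasses, §1 p. 645 L1–L14 and §2 L1–L3] -/
theorem Polarization.eigenspace_one_eq_ker_of_coe_eq_one_sub (ψ : Polarization H) {γ : ψ.lefschetzGroupBaseChange K}
    {e : Module.End K (K ⊗[ℚ] V)}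
    (hγe : ((γ : (K ⊗[ℚ] V) ≃ₗ[K] (K ⊗[ℚ] V)) : Module.End K (K ⊗[ℚ] V)) = 1 - (e + e)) :
    Module.End.eigenspace (((γ : (K ⊗[ℚ] V) ≃ₗ[K] (K ⊗[ℚ] V)) : Module.End K (K ⊗[ℚ] V))) 1 = LinearMap.ker e := by
  have h2K : (2 : K) ≠ 0 := by
    rw [← map_ofNat (algebraMap ℚ K) 2]
    exact (map_ne_zero _).2 two_ne_zero
  ext x
  rw [Module.End.mem_eigenspace_iff, hγe, LinearMap.sub_apply, Module.End.one_apply, LinearMap.add_apply, one_smul,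
    LinearMap.mem_ker, sub_eq_self]
  constructor
  · intro h
    exact eq_of_add_self_eq₅₅₁₃ K h2K (by rw [h, add_zero])
  · intro h
    rw [h, add_zero]

omit [Module.Finite ℚ V] in
/-- **THE IDEMPOTENT IS UNIQUE**: `1 − 2e = 1 − 2e' ⟹ e = e'` on `K ⊗ V` (`char K ≠ 2`) — each central `γ ∈ S(A)(K)` is labelled
by exactly one idempotent of `C₀ ⊗ K`. [cite: Milne1999LefschetzClasses, §1 p. 645 L1–L14 (S₀, Prop. 1.7) and Remark 1.6 (p. 644)] -/
theorem Polarization.isIdempotentElem_unique_of_coe_eq_one_sub (ψ : Polarization H) {γ : ψ.lefschetzGroupBaseChange K}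
    {e e' : Module.End K (K ⊗[ℚ] V)}
    (hγe : ((γ : (K ⊗[ℚ] V) ≃ₗ[K] (K ⊗[ℚ] V)) : Module.End K (K ⊗[ℚ] V)) = 1 - (e + e))
    (hγe' : ((γ : (K ⊗[ℚ] V) ≃ₗ[K] (K ⊗[ℚ] V)) : Module.End K (K ⊗[ℚ] V)) = 1 - (e' + e')) : e = e' := by
  have h2K : (2 : K) ≠ 0 := by
    rw [← map_ofNat (algebraMap ℚ K) 2]
    exact (map_ne_zero _).2 two_ne_zero
  have h : e + e = e' + e' := sub_right_injective (hγe.symm.trans hγe')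
  refine LinearMap.ext fun x => eq_of_add_self_eq₅₅₁₃ K h2K ?_
  simpa only [LinearMap.add_apply] using congrArg (fun f : Module.End K (K ⊗[ℚ] V) => f x) h

end HodgeStructure

end Literature.AlgebraicGeometry.Motives
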